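import Mathlib
import Summits.NavierStokesRegularity.FluidComputer.AbcLatticeEigenSynthesis

/-!
# The CONVERSE of the eigen synthesis: a classical eigenpair of the linearisation gives a solution of
# the certifiers' lattice eigen-equation (profile-cert-3 g8, cell `ns-blowup`, 2026-08-27)

HONEST FRAMING (D-0035/D-0074): not a claim about Navier–Stokes blow-up. WHAT THIS IS NOT: not NS evidence;
MODEL lane (NS linearised about a steady state on the unit torus, in particular the forced ABC flow);
no certificate, number or census word moves. instab4 g5's `AbcLatticeEigenSynthesis` is the direction
«lattice eigen-equation ⇒ `Torus.IsLinNSEigenvalue`». This file is the OTHER direction, the first half of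
the (D7) item of the 3-B-nested rows (reading ISOLATION in coordinates as «no other eigenvalue»):
* `fourier_eigen_of_linNSResolventRel` — for a smooth background `u₀` and ANY classical eigenpair
  `Torus.LinNSResolventRel ν u₀ μ w 0` (w smooth, divergence free, mean zero, `νΔw − (u₀·∇)w − (w·∇)u₀ −
  ∇q = μw`), the Fourier coefficient family `c = 𝓕 w` is rapidly decaying, transversal, `c 0 = 0`, and
  solves the projected lattice equation `ν·4π²|k|² c(k) + Π_k (N(û₀, c) + N(c, û₀))(k) + μ c(k) = 0`
  (Fourier coefficients of each term — `Torus.mFourierCoeff_laplacian`, `mFourierCoeff_convect_complex`,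
  `mFourierCoeff_stretch`, `mFourierCoeff_gradientC` — then `Π_k` kills the pressure, `lerayCoeff_freqVec`);
* `certifier_eigen_of_linNSResolventRel_abcFlow` — at `u₀ = Torus.abcFlow A B C`, `ν = 1/(2πR)`, `μ = 2πλ`:
  THE CERTIFIERS' EIGEN-EQUATION `−(|k|²/R) c(k) + Π_k Σ_{s∈{±e_j}} Û(s) × (i(k−s) × c(k−s) − c(k−s)) = λ c(k)`
  (`lerayCoeff_linSym_abcFlow`), with `c ≠ 0` iff `w ≠ 0` (`IsSmooth.ext_mFourierCoeff`).
Mathlib + `AbcLatticeEigenSynthesis` (transitively the Literature Fourier layer); no new definitions.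
bears_on LADDER-NS N5 / Z4-a(1) ((D7) for the 3-B-nested rows). [folklore].
-/

noncomputable section

open scoped BigOperators ComplexConjugate Matrix
open Filter Set Function MeasureTheory UnitAddTorus

namespace Summit.NavierStokesRegularity.FluidComputer.AbcLatticeEigenAnalysis

open Literature.Analysis.FunctionSpaces Literature.Analysis.FunctionSpaces.Torus
open Literature.Analysis.FunctionSpaces.EuclideanSpace
open Literature.Analysis.FluidPDE Literature.Analysis.FluidPDE.ScalarFourier
open Literature.Analysis.FluidPDE.SteadyLattice

/-! ## §1 The Fourier side of a classical eigenpair, general smooth background -/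

/-- **A classical eigenpair solves the projected lattice eigen-equation.** -/
theorem fourier_eigen_of_linNSResolventRel {ν : ℝ}
    {u₀ : UnitAddTorus (Fin 3) → EuclideanSpace ℝ (Fin 3)} (hu₀ : IsSmooth u₀) (μ : ℂ)
    {w : UnitAddTorus (Fin 3) → EuclideanSpace ℂ (Fin 3)} (hw : Torus.LinNSResolventRel ν u₀ μ w 0) :
    RapidDecay (mFourierCoeff w) ∧
      (∀ k : Fin 3 → ℤ, (∑ jj : Fin 3, ((k jj : ℤ) : ℂ) * (mFourierCoeff w k) jj) = 0) ∧
      mFourierCoeff w 0 = 0 ∧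
      ∀ k : Fin 3 → ℤ, (((ν * (4 * Real.pi ^ 2 * freqNormSq k)) : ℝ) : ℂ) • mFourierCoeff w k +
        Torus.lerayCoeff k ((WithLp.toLp 2 (fun pp : Fin 3 => transportSym (fun jj mm =>
            (mFourierCoeff (complexify ∘ u₀)) mm jj) (fun mm => mFourierCoeff w mm pp) k) : EuclideanSpace ℂ (Fin 3)) +
          (WithLp.toLp 2 (fun pp : Fin 3 => transportSym (fun jj mm => mFourierCoeff w mm jj) (fun mm =>
            (mFourierCoeff (complexify ∘ u₀)) mm pp) k) : EuclideanSpace ℂ (Fin 3))) +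
        μ • mFourierCoeff w k = 0 := by
  obtain ⟨hws, hdiv, hmean, q, hq, hpde⟩ := hw
  set c : (Fin 3 → ℤ) → EuclideanSpace ℂ (Fin 3) := mFourierCoeff w with hcdef
  -- transversality from `div w = 0`
  have hwl : ∀ l, IsSmooth (fun x => w x l) := fun l =>
    hws.comp_clm ((EuclideanSpace.proj l : (EuclideanSpace ℂ (Fin 3)) →L[ℂ] ℂ).restrictScalars ℝ)
  have hct : ∀ k : Fin 3 → ℤ, (∑ jj : Fin 3, ((k jj : ℤ) : ℂ) * (c k) jj) = 0 := by
    intro k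
    set D : UnitAddTorus (Fin 3) → ℂ := fun z => ∑ l, Torus.partialDeriv l (fun x => w x l) z with hD
    have hD0 : D = 0 := by
      funext z
      have hz := hdiv z
      rw [Pi.zero_apply]
      simpa only [hD, Torus.divergenceC] using hz
    have hDk : mFourierCoeff D k = 0 := by rw [hD0]; simp [mFourierCoeff]
    rw [hD, mFourierCoeff_finset_sum (f := fun l => Torus.partialDeriv l (fun x => w x l)) _
      (fun l _ => ((hwl l).partialDeriv l).integrable)] at hDk
    have h2 : ∀ l, mFourierCoeff (Torus.partialDeriv l (fun x => w x l)) k = dsym l k * c k l := fun l => by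
      rw [mFourierCoeff_partialDeriv (hwl l) l k, coeff_apply_complex hws k l, dsym_apply, smul_eq_mul]
    simp only [h2, dsym_apply] at hDk
    have hI : (2 * Real.pi * Complex.I : ℂ) ≠ 0 :=
      mul_ne_zero (mul_ne_zero two_ne_zero (by exact_mod_cast Real.pi_ne_zero)) Complex.I_ne_zero
    have h3 : 2 * ↑Real.pi * Complex.I * (∑ jj : Fin 3, ((k jj : ℤ) : ℂ) * (c k) jj) = 0 := by
      rw [Finset.mul_sum, ← hDk]
      exact Finset.sum_congr rfl fun l _ => by ring
    exact (mul_eq_zero.mp h3).resolve_left hI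
  have hc0 : c 0 = 0 := mFourierCoeff_zero_of_hasZeroMean hmean
  refine ⟨hws.rapidDecay_mFourierCoeff, hct, hc0, fun k => ?_⟩
  -- the PDE, coefficientwise
  have hE0 : (fun y => Torus.linearizedNSOperator ν u₀ w q y - μ • w y) = 0 := by
    funext y; exact hpde y
  have i1 : Integrable (fun y => laplacian w y) volume := hws.laplacian.integrable
  have i1' : Integrable ((ν : ℂ) • fun y => laplacian w y) volume := i1.smul (ν : ℂ)
  have i2 : Integrable (Torus.convect u₀ w) volume := (hu₀.convect hws).integrable
  have i3 : Integrable (Torus.stretch w u₀) volume := (isSmooth_stretch hu₀ hws).integrable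
  have c4 : Continuous fun y => Torus.gradientC q y :=
    (PiLp.continuous_toLp 2 _).comp (continuous_pi fun l => (hq.partialDeriv l).continuous)
  have i4 : Integrable (Torus.gradientC q) volume := c4.integrable_unitAddTorus
  have i5 : Integrable (μ • w) volume := hws.integrable.smul μ
  have hfun : (fun y => Torus.linearizedNSOperator ν u₀ w q y - μ • w y) =
      ((ν : ℂ) • fun y => laplacian w y) - (Torus.convect u₀ w + Torus.stretch w u₀) - Torus.gradientC q - μ • w := by
    funext y
    simp only [Torus.linearizedNSOperator_apply, Pi.sub_apply, Pi.add_apply, Pi.smul_apply, Complex.coe_smul]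
  have hk : mFourierCoeff (fun y => Torus.linearizedNSOperator ν u₀ w q y - μ • w y) k =
      mFourierCoeff (0 : UnitAddTorus (Fin 3) → EuclideanSpace ℂ (Fin 3)) k := by rw [hE0]
  rw [hfun, mFourierCoeff_sub ((i1'.sub (i2.add i3)).sub i4) i5, mFourierCoeff_sub (i1'.sub (i2.add i3)) i4,
    mFourierCoeff_sub i1' (i2.add i3), mFourierCoeff_add i2 i3, mFourierCoeff_const_smul, mFourierCoeff_const_smul,
    mFourierCoeff_convect_complex hu₀ hws k, mFourierCoeff_stretch hu₀ hws k, mFourierCoeff_gradientC hq k,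
    show (fun y => laplacian w y) = laplacian w from rfl, Torus.mFourierCoeff_laplacian hws k] at hk
  have hk0 : mFourierCoeff (0 : UnitAddTorus (Fin 3) → EuclideanSpace ℂ (Fin 3)) k = 0 := by simp [mFourierCoeff]
  rw [hk0] at hk
  -- apply `Π_k`: the pressure disappears, `c k` is fixed
  have hP0 : Torus.lerayCoeff k (0 : EuclideanSpace ℂ (Fin 3)) = 0 := by
    have h := lerayCoeff_smul' k (0 : ℂ) (0 : EuclideanSpace ℂ (Fin 3))
    rw [zero_smul, zero_smul] at h
    exact h
  have hPc : Torus.lerayCoeff k (c k) = c k := by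
    by_cases hkz : k = 0
    · subst hkz; rw [hc0, hP0]
    · exact lerayCoeff_of_kdot_eq_zero hkz (hct k)
  have hP := congrArg (Torus.lerayCoeff k) hk
  rw [hP0] at hP
  -- expand `Π_k` over the difference
  have hlin : ∀ x y : EuclideanSpace ℂ (Fin 3), Torus.lerayCoeff k (x - y) = Torus.lerayCoeff k x - Torus.lerayCoeff k y := by
    intro x y
    have h := lerayCoeff_add' k (x - y) y
    rw [sub_add_cancel] at h
    exact eq_sub_of_add_eq h.symm
  rw [hlin, hlin, hlin, lerayCoeff_smul' k (2 * ↑Real.pi * Complex.I * mFourierCoeff q k), lerayCoeff_freqVec,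
    smul_zero, sub_zero, lerayCoeff_smul' k μ, hPc, lerayCoeff_smul' k (ν : ℂ), ← neg_smul, lerayCoeff_smul',
    hPc] at hP
  -- `hP : ν • ((−4π²|k|²) • c k) − Π M − μ • c k = 0`
  have e : (((ν * (4 * Real.pi ^ 2 * freqNormSq k)) : ℝ) : ℂ) • c k =
      (ν : ℂ) • ((((4 * Real.pi ^ 2 * freqNormSq k : ℝ)) : ℂ) • c k) := by
    rw [smul_smul, ← Complex.ofReal_mul]
  rw [e]
  linear_combination (norm := module) -hP

/-! ## §2 The ABC background: the certifiers' eigen-equation from a classical eigenpair -/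

/-- **A classical eigenpair of the linearisation about the ABC flow solves THE CERTIFIERS' EIGEN-EQUATION**
(the converse of `AbcLatticeEigenSynthesis.isLinNSEigenvalue_abcFlow_of_certifier_eigen`): for `R > 0`
and `Torus.LinNSResolventRel (1/(2πR)) (abcFlow A B C) (2πλ) w 0`, the family `c = 𝓕 w` is rapidly
decaying, transversal, `c 0 = 0`, satisfies
`−(|k|²/R) c(k) + Π_k Σ_{s∈{±e_j}} Û(s) × (i(k−s) × c(k−s) − c(k−s)) = λ c(k)`, and `c ≠ 0` if `w ≠ 0`. -/
theorem certifier_eigen_of_linNSResolventRel_abcFlow (A B C : ℝ) {R : ℝ} (hR : 0 < R) (lam : ℂ)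
    {w : UnitAddTorus (Fin 3) → EuclideanSpace ℂ (Fin 3)}
    (hw : Torus.LinNSResolventRel (1 / (2 * Real.pi * R)) (Torus.abcFlow A B C) (2 * Real.pi * lam) w 0) :
    RapidDecay (mFourierCoeff w) ∧
      (∀ k : Fin 3 → ℤ, (∑ jj : Fin 3, ((k jj : ℤ) : ℂ) * (mFourierCoeff w k) jj) = 0) ∧
      mFourierCoeff w 0 = 0 ∧
      (∀ k : Fin 3 → ℤ, ((-(freqNormSq k / R) : ℝ) : ℂ) • mFourierCoeff w k +
        Torus.lerayCoeff k (∑ s ∈ Torus.abcFreq, (WithLp.toLp 2 (crossProduct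
            (WithLp.ofLp (Torus.abcCoeff A B C s))
            (Complex.I • crossProduct (fun j => (((k - s) j : ℤ) : ℂ)) (WithLp.ofLp (mFourierCoeff w (k - s))) -
              WithLp.ofLp (mFourierCoeff w (k - s)))) : EuclideanSpace ℂ (Fin 3))) = lam • mFourierCoeff w k) ∧
      (w ≠ 0 → mFourierCoeff w ≠ 0) := by
  obtain ⟨hcr, hct, hc0, heq⟩ := fourier_eigen_of_linNSResolventRel (Torus.isSmooth_abcFlow A B C) _ hw
  have hws : IsSmooth w := hw.1
  refine ⟨hcr, hct, hc0, fun k => ?_, fun hne hc => hne ?_⟩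
  · have h := heq k
    rw [AbcLatticeEigenSynthesis.lerayCoeff_linSym_abcFlow] at h
    have hπ : (Real.pi : ℝ) ≠ 0 := Real.pi_ne_zero
    have hν : ((((1 / (2 * Real.pi * R)) * (4 * Real.pi ^ 2 * freqNormSq k)) : ℝ) : ℂ) =
        (2 * Real.pi : ℂ) * ((freqNormSq k / R : ℝ) : ℂ) := by
      have h1 : (1 / (2 * Real.pi * R)) * (4 * Real.pi ^ 2 * freqNormSq k) = 2 * Real.pi * (freqNormSq k / R) := by
        field_simp
        ring
      rw [h1]; push_cast; ring
    rw [hν] at h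
    have h2π : (2 * Real.pi : ℂ) ≠ 0 := mul_ne_zero two_ne_zero (by exact_mod_cast hπ)
    -- divide the identity by `−2π`
    have h' : (2 * Real.pi : ℂ) • ((((freqNormSq k / R : ℝ) : ℂ)) • mFourierCoeff w k -
        Torus.lerayCoeff k (∑ s ∈ Torus.abcFreq, (WithLp.toLp 2 (crossProduct
            (WithLp.ofLp (Torus.abcCoeff A B C s))
            (Complex.I • crossProduct (fun j => (((k - s) j : ℤ) : ℂ)) (WithLp.ofLp (mFourierCoeff w (k - s))) -
              WithLp.ofLp (mFourierCoeff w (k - s)))) : EuclideanSpace ℂ (Fin 3))) + lam • mFourierCoeff w k) = 0 := by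
      rw [← h]
      push_cast
      module
    have h'' := (smul_eq_zero.mp h').resolve_left h2π
    push_cast
    linear_combination (norm := module) -h''
  · exact hws.ext_mFourierCoeff (by
      change ContDiff ℝ _ (Torus.lift (0 : UnitAddTorus (Fin 3) → EuclideanSpace ℂ (Fin 3)))
      exact contDiff_const) fun k => by rw [hc]; simp [mFourierCoeff]

end Summit.NavierStokesRegularity.FluidComputer.AbcLatticeEigenAnalysis

end
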